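import Literature.NumberTheory.EllipticCurves.TwoIsogenySelmerGroupProofs
import Literature.NumberTheory.EllipticCurves.BinaryQuarticGoodReductionSolubilityProofs
import Literature.NumberTheory.EllipticCurves.BinaryQuarticLocalSolubility
import Literature.NumberTheory.DiophantineGeometry.LindMordellQuarticsHassePrincipleFailure
import Literature.NumberTheory.LocalFields.PadicSquareRootMinusOne
import Literature.NumberTheory.QuadraticForms.PadicSquares
import Literature.NumberTheory.EllipticCurves.TianYuanZhang2017.GenusPeriodsParity
import Mathlib.NumberTheory.LegendreSymbol.QuadraticReciprocity
import HarnessLib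

/-!
# Crux `PrintCf2.RamifiedOffTYZOfFacts` (stmt-BirchSwinnertonDyer-20509), line `offtyz-v7`, LEAD cycle 21 (cruxlead-20509 g20), part 4/6:
# LOCAL TOOLS FOR DIAGONAL QUARTICS `w² = A u⁴ + E z⁴` and the everywhere-local solubility of `w² = P u⁴ − R²P z⁴`

THEOREMS ONLY (no `def`, no named fact, no `sorry`), `--supports stmt-BirchSwinnertonDyer-20509`.  HONEST FRAMING: descent bookkeeping in the
tree's explicit `2`-isogeny Selmer vocabulary (`TwoIsogenySelmerGroup`: `twoIsogenyQuartic a d d' = ⟨d, 0, a, 0, d'⟩`,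
`BinaryQuartic.IsLocallySoluble`) with the tree's Hensel / good-reduction tools (`BinaryQuarticHenselSolubility`,
`BinaryQuarticGoodReductionSolubilityProofs`, `LindMordellQuarticsHassePrincipleFailure`).  Parts 5/6 use these to PROVE the two
isogeny Selmer dimensions `dim S(0,−l²q²) = 3`, `dim S'(0,−l²q²) = 2` on the block-free two-prime sector R2 that parts 1–3 took as hypotheses.
Nothing about BSD is asserted; C⁺ (23431) and the crux stay OPEN.

* §6 `eval_map_diag`, `disc_diag` (`Δ = 2⁸A³E³`), `isSoluble_padic_diag_of_point`, `exists_sq_eq_two_of_emod_eight` (`c ≡ 1 (8)` is a square in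
  `ℤ₂`), `isSoluble_padic_diag_of_five_le` (good reduction at `p ≥ 5`, `p ∤ AE`), and the `q`-ADIC OBSTRUCTION
  `not_isSoluble_padic_diag_of_dvd_both`: `−d₁e₁` a non-residue mod `q` ⟹ `w² = q d₁ u⁴ + q e₁ z⁴` has no `ℚ_q`-point.
* §7 `isLocallySoluble_diag_prime_negSq`: for distinct primes `P, R ∉ {2,3}`, `P ≡ ±1 (mod 8)`, `R` a square mod `P` and `P` a square mod
  `R`, the form `w² = P u⁴ − R²P z⁴` is everywhere locally soluble (exact zero `u = √R ∈ ℤ_P` at `P`; `(1,0,√P)` at `R`; `2`, `3` by hand;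
  good reduction elsewhere) — the classes `l` and `q` of `Sel^{(φ̂)}(A_{lq} → E_{lq})`.
Beyond-print theorem: NO.  BSD is not proved by any of this.

References: [cite: SilvermanAEC2009, Prop. X.4.9, Example X.4.10, proof of Prop. X.6.2(b) (local solubility of the C_d)];
[cite: BhargavaShankarAnnals2015, Prop. 3.18 (good reduction ⟹ ℚ_p-soluble)]; tree: `TwoIsogenySelmerXCubeAddPX*` (the one-prime family `x³ + px`).
-/

noncomputable section

open scoped Classical

open WeierstrassCurve Literature.NumberTheory Literature.NumberTheory.EllipticCurves Literature.NumberTheory.DiophantineGeometry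
  Literature.NumberTheory.DiophantineGeometry.LindMordellQuartics Literature.NumberTheory.EllipticCurves.TianYuanZhang2017

namespace Summit.BirchSwinnertonDyer.PrintCf2.PartnerSha

/-! ## §6 Local tools for diagonal quartics `w² = A u⁴ + E z⁴` -/

/-- Values of the diagonal form after base change. [folklore] -/
theorem eval_map_diag {S : Type*} [CommRing S] (φ : ℤ →+* S) (A E : ℤ) (x y : S) :
    ((⟨A, 0, 0, 0, E⟩ : BinaryQuartic ℤ).map φ).eval x y = φ A * x ^ 4 + φ E * y ^ 4 := by
  simp only [BinaryQuartic.eval, BinaryQuartic.map, map_zero]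
  ring

/-- `Δ(⟨A, 0, 0, 0, E⟩) = 2⁸ A³ E³`. [folklore] -/
theorem disc_diag (A E : ℤ) : (⟨A, 0, 0, 0, E⟩ : BinaryQuartic ℤ).disc = 256 * A ^ 3 * E ^ 3 := by
  simp only [BinaryQuartic.disc]; ring

/-- The `2`-isogeny quartic `twoIsogenyQuartic 0 d d'` is the diagonal form `⟨d, 0, 0, 0, d'⟩`. [folklore] -/
theorem twoIsogenyQuartic_zero (d d' : ℤ) : twoIsogenyQuartic 0 d d' = (⟨d, 0, 0, 0, d'⟩ : BinaryQuartic ℤ) := rfl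

/-- A `ℤ_p`-point `(x, y, z)` of `z² = A x⁴ + E y⁴` gives `ℚ_p`-solubility. [folklore] -/
theorem isSoluble_padic_diag_of_point {p : ℕ} [Fact p.Prime] {A E : ℤ} {x y z : ℤ_[p]} (hxy : x ≠ 0 ∨ y ≠ 0)
    (h : z ^ 2 = (A : ℤ_[p]) * x ^ 4 + (E : ℤ_[p]) * y ^ 4) :
    ((⟨A, 0, 0, 0, E⟩ : BinaryQuartic ℤ).map (Int.castRingHom ℚ_[p])).IsSoluble := by
  rw [← BinaryQuartic.map_intCast_map_coe]
  refine BinaryQuartic.isSoluble_map_coe_of_eval_eq_sq _ hxy (z := z) ?_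
  rw [eval_map_diag]; simpa using h

/-- A unit square modulo `8` is a square in `ℤ₂`: `c ≡ 1 (mod 8) ⟹ ∃ r ∈ ℤ₂, r² = c`. [folklore] -/
theorem exists_sq_eq_two_of_emod_eight {c : ℤ} (hc : c % 8 = 1) : ∃ r : ℤ_[2], r ^ 2 = c := by
  have hmod : PadicInt.toZModPow 3 ((c : ℤ) : ℤ_[2]) = 1 := by
    rw [map_intCast]
    have : ((c : ℤ) : ZMod (2 ^ 3)) = ((c % 8 : ℤ) : ZMod (2 ^ 3)) := by
      rw [show (2 ^ 3 : ℕ) = 8 from rfl]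
      exact (ZMod.intCast_mod c 8).symm
    rw [this, hc, Int.cast_one]
  obtain ⟨r, hr⟩ := QuadraticForms.padicInt_isSquare_of_toZModPow_three_eq_one (p := 2) hmod
  exact ⟨r, by rw [hr]; ring⟩

/-- **Good reduction**: for a prime `p ≥ 5` not dividing `A E`, `z² = A u⁴ + E z⁴` is `ℚ_p`-soluble
(`Δ = 2⁸A³E³`; Bhargava–Shankar Prop. 3.18 in the tree). [cite: SilvermanAEC2009, Prop. X.4.9 (the places outside S are automatic)] -/
theorem isSoluble_padic_diag_of_five_le {p : ℕ} [Fact p.Prime] (hp5 : 5 ≤ p) {A E : ℤ} (hA : ¬ (p : ℤ) ∣ A)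
    (hE : ¬ (p : ℤ) ∣ E) :
    ((⟨A, 0, 0, 0, E⟩ : BinaryQuartic ℤ).map (Int.castRingHom ℚ_[p])).IsSoluble := by
  refine BinaryQuartic.isSoluble_padic_of_not_dvd_disc hp5 _ ?_
  rw [disc_diag]
  have hp : Prime (p : ℤ) := Nat.prime_iff_prime_int.mp (Fact.out : p.Prime)
  intro h
  have h2 : ¬ (p : ℤ) ∣ 256 := by
    intro h256
    have : (p : ℤ) ∣ 2 ^ 8 := by norm_num at h256 ⊢; exact h256
    have h2' := hp.dvd_of_dvd_pow this
    have : (p : ℤ) ≤ 2 := Int.le_of_dvd (by norm_num) h2'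
    omega
  rcases hp.dvd_or_dvd h with h1 | h1
  · rcases hp.dvd_or_dvd h1 with h3 | h3
    · exact h2 h3
    · exact hA (hp.dvd_of_dvd_pow h3)
  · exact hE (hp.dvd_of_dvd_pow h1)

/-- **The `q`-adic obstruction for doubly `q`-divisible diagonal forms**: if `−d₁e₁` is not a square modulo the
prime `q`, then `w² = q d₁ u⁴ + q e₁ z⁴` has no `ℚ_q`-point (an integral point with a unit coordinate has
`q ∣ w`, then `d₁ uˢ⁴ + e₁ z⁴ ≡ 0`, exhibiting `−d₁e₁` as a square). [cite: SilvermanAEC2009, Example X.4.10 (the argument)] -/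
theorem not_isSoluble_padic_diag_of_dvd_both {q : ℕ} [hq : Fact q.Prime] {d₁ e₁ : ℤ}
    (h : ¬ IsSquare (((-(d₁ * e₁) : ℤ)) : ZMod q)) :
    ¬ ((⟨q * d₁, 0, 0, 0, q * e₁⟩ : BinaryQuartic ℤ).map (Int.castRingHom ℚ_[q])).IsSoluble := by
  intro hsol
  rw [← BinaryQuartic.map_intCast_map_coe, BinaryQuartic.isSoluble_map_coe_iff] at hsol
  have hev : ∀ x y : ℤ_[q], ((⟨q * d₁, 0, 0, 0, q * e₁⟩ : BinaryQuartic ℤ).map (Int.castRingHom ℤ_[q])).eval x y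
      = (q : ℤ_[q]) * ((d₁ : ℤ_[q]) * x ^ 4 + (e₁ : ℤ_[q]) * y ^ 4) := fun x y => by
    rw [eval_map_diag]; simp; ring
  have hq0 : (q : ℤ_[q]) ≠ 0 := by exact_mod_cast hq.out.ne_zero
  have hqbar : PadicInt.toZMod (q : ℤ_[q]) = 0 := by
    rw [map_natCast, ZMod.natCast_self]
  -- common core: from `z² = q·m` with `m ∈ ℤ_q` deduce `toZMod m = 0`
  have core : ∀ z m : ℤ_[q], z ^ 2 = (q : ℤ_[q]) * m → PadicInt.toZMod m = 0 := by
    intro z m hzm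
    have hz : PadicInt.toZMod z = 0 := by
      have := congrArg PadicInt.toZMod hzm
      rw [map_pow, map_mul, hqbar, zero_mul] at this
      exact pow_eq_zero_iff two_ne_zero |>.mp this
    obtain ⟨w, hw⟩ := (BinaryQuartic.toZMod_eq_zero_iff z).mp hz
    rw [hw] at hzm
    have hm : m = (q : ℤ_[q]) * w ^ 2 := mul_left_cancel₀ hq0 (by linear_combination -hzm)
    rw [hm, map_mul, hqbar, zero_mul]
  rcases hsol with ⟨t, z, hz⟩ | ⟨t, z, hz⟩
  · rw [hev, one_pow, mul_one] at hz
    have h0 := core z _ hz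
    simp only [map_add, map_mul, map_pow, map_intCast] at h0
    apply h
    refine ⟨((e₁ : ℤ) : ZMod q) * PadicInt.toZMod t ^ 2, ?_⟩
    push_cast
    linear_combination (-(e₁ : ZMod q)) * h0
  · rw [hev, one_pow, mul_one] at hz
    have h0 := core z _ hz
    simp only [map_add, map_mul, map_pow, map_intCast] at h0
    apply h
    refine ⟨((d₁ : ℤ) : ZMod q) * PadicInt.toZMod t ^ 2, ?_⟩
    push_cast
    linear_combination (-(d₁ : ZMod q)) * h0

/-! ## §7 The template `w² = P u⁴ − R²P z⁴` (the classes `l`, `q` of `Sel^{(φ̂)}` on R2) -/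

/-- A prime `≥ 5` is what remains after excluding `2` and `3`. [folklore] -/
private theorem five_le_of_prime_ne {p : ℕ} (hp : p.Prime) (h2 : p ≠ 2) (h3 : p ≠ 3) : 5 ≤ p := by
  by_contra h
  interval_cases p <;> first | exact absurd hp (by decide) | omega

/-- Residues mod `3` of a prime `≠ 3`. [folklore] -/
private theorem mod_three_of_prime_ne_three {p : ℕ} (hp : p.Prime) (h3 : p ≠ 3) : p % 3 = 1 ∨ p % 3 = 2 := by
  have : p % 3 ≠ 0 := fun h0 => by
    have h := (Nat.dvd_prime hp).mp (Nat.dvd_of_mod_eq_zero h0)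
    omega
  omega

/-- In `ZMod 3`: if `P ≡ 2` and `R ≢ 0 (mod 3)` then `−R²P − 1 ≡ 0`. [folklore] -/
theorem three_dvd_neg_sq_mul_sub_one {P R : ℕ} (hP : P % 3 = 2) (hR : R % 3 = 1 ∨ R % 3 = 2) :
    ((3 : ℕ) : ℤ) ∣ -((R : ℤ) ^ 2 * P) - 1 ^ 2 := by
  have hP' : (P : ZMod 3) = 2 := by
    rw [← ZMod.natCast_mod P 3, hP]; rfl
  have hR' : (R : ZMod 3) ^ 2 = 1 := by
    rcases hR with h | h <;> rw [← ZMod.natCast_mod R 3, h] <;> decide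
  refine (ZMod.intCast_zmod_eq_zero_iff_dvd _ 3).mp ?_
  push_cast
  rw [hR', hP']; decide

/-- **The diagonal class `w² = P u⁴ − R² P z⁴` is everywhere locally soluble** for distinct primes `P, R ∉ {2, 3}` with
`P ≡ ±1 (mod 8)`, `R` a square mod `P` and `P` a square mod `R`: at `P` the exact zero `u = √R ∈ ℤ_P` (`P(u⁴ − R²) = 0`), at `R`
the point `(1, 0, √P)`, at `2` the point `(1, 0, √P)` resp. `(0, 1, R√−P)`, at `3` a unit square value, elsewhere good reduction.
[cite: SilvermanAEC2009, Prop. X.4.9, Example X.4.10 (method)] -/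
theorem isLocallySoluble_diag_prime_negSq {P R : ℕ} [hPp : Fact P.Prime] [hRp : Fact R.Prime] (hPR : P ≠ R)
    (hP8 : P % 8 = 1 ∨ P % 8 = 7) (hR2 : R ≠ 2) (hR3 : R ≠ 3)
    (hRP : IsSquare ((R : ℤ) : ZMod P)) (hPRsq : IsSquare ((P : ℤ) : ZMod R)) :
    (⟨P, 0, 0, 0, -((R : ℤ) ^ 2 * P)⟩ : BinaryQuartic ℤ).IsLocallySoluble := by
  have hP := hPp.out
  have hR := hRp.out
  have hP2 : P ≠ 2 := by rintro rfl; omega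
  have hP3 : P ≠ 3 := by rintro rfl; omega
  have hP0 : (P : ℤ) ≠ 0 := by exact_mod_cast hP.ne_zero
  have hR0 : (R : ℤ) ≠ 0 := by exact_mod_cast hR.ne_zero
  have hPnR : ¬ (P : ℤ) ∣ R := by
    intro h
    have := (Nat.prime_dvd_prime_iff_eq hP hR).mp (by exact_mod_cast h)
    exact hPR this
  have hRnP : ¬ (R : ℤ) ∣ P := by
    intro h
    have := (Nat.prime_dvd_prime_iff_eq hR hP).mp (by exact_mod_cast h)
    exact hPR this.symm
  refine ⟨?_, fun p hp => ?_⟩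
  · -- real: `P > 0`
    have := isSoluble_real_twoIsogenyQuartic_of_pos (d := P) (by exact_mod_cast hP.pos) 0 (-((R : ℤ) ^ 2 * P))
    rwa [twoIsogenyQuartic_zero] at this
  · have hpP := hp.out
    by_cases hpeqP : p = P
    · -- `p = P`: the zero `(√R, 1, 0)`
      subst hpeqP
      obtain ⟨s, hs⟩ := exists_sq_eq_intCast_of_isSquare hP2 hPnR hRP
      refine isSoluble_padic_diag_of_point (x := s) (y := 1) (z := 0) (Or.inr one_ne_zero) ?_
      have hs4 : s ^ 4 = ((R : ℤ) : ℤ_[p]) ^ 2 := by rw [← hs]; ring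
      rw [hs4]; push_cast; ring
    by_cases hpeqR : p = R
    · -- `p = R`: the point `(1, 0, √P)`
      subst hpeqR
      obtain ⟨r, hr⟩ := exists_sq_eq_intCast_of_isSquare hR2 hRnP hPRsq
      exact isSoluble_padic_diag_of_point (x := 1) (y := 0) (z := r) (Or.inl one_ne_zero)
        (by rw [hr]; push_cast; ring)
    by_cases hp2 : p = 2
    · subst hp2
      rcases hP8 with h1 | h7
      · -- `(1, 0, √P)`, `P ≡ 1 (mod 8)`
        obtain ⟨r, hr⟩ := exists_sq_eq_two_of_emod_eight (c := P) (by exact_mod_cast (show (P : ℤ) % 8 = 1 by omega))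
        exact isSoluble_padic_diag_of_point (x := 1) (y := 0) (z := r) (Or.inl one_ne_zero)
          (by rw [hr]; push_cast; ring)
      · -- `(0, 1, R√−P)`, `−P ≡ 1 (mod 8)`
        obtain ⟨r, hr⟩ := exists_sq_eq_two_of_emod_eight (c := -(P : ℤ)) (by omega)
        exact isSoluble_padic_diag_of_point (x := 0) (y := 1) (z := R * r) (Or.inr one_ne_zero)
          (by rw [mul_pow, hr]; push_cast; ring)
    by_cases hp3 : p = 3
    · subst hp3
      rcases mod_three_of_prime_ne_three hP hP3 with h1 | h2
      · -- `(1, 0, √P)`, `P ≡ 1 (mod 3)`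
        obtain ⟨r, hr⟩ := exists_sq_eq_intCast (q := 3) (by norm_num) (c := P) (w := 1) (by norm_num)
          (by omega)
        exact isSoluble_padic_diag_of_point (x := 1) (y := 0) (z := r) (Or.inl one_ne_zero)
          (by rw [hr]; push_cast; ring)
      · -- `(0, 1, √(−R²P))`, `P ≡ 2 (mod 3)`
        obtain ⟨r, hr⟩ := exists_sq_eq_intCast (q := 3) (by norm_num) (c := -((R : ℤ) ^ 2 * P)) (w := 1)
          (by norm_num) (three_dvd_neg_sq_mul_sub_one h2 (mod_three_of_prime_ne_three hR hR3))
        exact isSoluble_padic_diag_of_point (x := 0) (y := 1) (z := r) (Or.inr one_ne_zero)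
          (by rw [hr]; push_cast; ring)
    · -- good reduction at `p ≥ 5`, `p ∉ {P, R}`
      have hp5 := five_le_of_prime_ne hpP hp2 hp3
      have hpi : Prime (p : ℤ) := Nat.prime_iff_prime_int.mp hpP
      have hpnP : ¬ (p : ℤ) ∣ P := fun h =>
        hpeqP ((Nat.prime_dvd_prime_iff_eq hpP hP).mp (by exact_mod_cast h))
      have hpnR : ¬ (p : ℤ) ∣ R := fun h =>
        hpeqR ((Nat.prime_dvd_prime_iff_eq hpP hR).mp (by exact_mod_cast h))
      refine isSoluble_padic_diag_of_five_le hp5 hpnP ?_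
      intro h
      rw [dvd_neg] at h
      rcases hpi.dvd_or_dvd h with h1 | h1
      · exact hpnR (hpi.dvd_of_dvd_pow h1)
      · exact hpnP h1

end Summit.BirchSwinnertonDyer.PrintCf2.PartnerSha

end
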